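import Literature.MathematicalPhysics.KineticTheory.HardSphereEulerProofs
import HarnessLib

/-!
# Band-coherence drift witness, I: the radial weight and pathwise window facts

Negative knowledge for the crux `OneFlightGossipEngine.BandCoherenceLDAlongFamilies` (stmt-AtomisticToContinuum-17700):
the GALILEAN-DRIFT WITNESS of refuter-rattack-stmt-AtomisticToContinuum-17700-0 (item evidence WITNESS.md).  The tested
band-coherence functional `S = Σᵢ 1{η cubᵢ < ‖q̄ᵢ‖} cubBandᵢ` has a non-zero LINEAR response to a uniform boost `D e₀` of
the homogeneous reference law, whose relative-entropy cost `(N+1)D²/2` is QUADRATIC, while the statement demands the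
exponential moment at the FIXED tilt `(8Θ̄K₁)⁻¹` to be `≤ e^{ε(N+1)}` for every `ε > 0`.  No Theses declaration is asserted
positively in this file (pure helper theorems, no definitions).

This file: §1 the witness radial weight `R(s′) = (s′ − k²)·1{k² < s′ ≤ K²}` (written inline everywhere; admissible:
`R = 0` below `k²`, `|R| ≤ |s′|`, measurable) and the pointwise domination `‖R(‖v‖²) v‖ ≤ 1{k<‖v‖≤K}‖v‖³ ≤ K³`;
§2 for a measurable signal `W : ℝ → ℝ³` on a window `[0, w]`: `‖q̄‖ ≤ cubBand`, the `0`-coordinate of `q̄` is the window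
average of `R(‖W‖²)W₀`, and the coherence summand dominates the LINEAR functional `q̄₀ − η cub`
(`linear_le_summand`) — the pathwise half of the entropy-inequality lower bound.

References: S. Olla, S. R. S. Varadhan, H.-T. Yau, Comm. Math. Phys. 155 (1993) §2 (entropy inequality);
H. Spohn, *Large Scale Dynamics of Interacting Particles* (1991), Part I §2.3.
-/

noncomputable section

open MeasureTheory ProbabilityTheory Set Filter Topology
open scoped ENNReal InnerProductSpace BigOperators

namespace Summit.AtomisticToContinuum.HydrodynamicLimit.Theorems

namespace BandCoherenceLDNegative

open Literature.MathematicalPhysics.KineticTheory Literature.Analysis.FluidPDE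

/-! ## §1 The radial weight of the witness and pointwise facts on `ℝ³` -/

/-- The witness radial weight `R(s′) = (s′ − k²)·1{k² < s′ ≤ K²}` is Borel measurable. [folklore] -/
theorem measurable_Rrad (k K : ℝ) : Measurable (fun s' : ℝ => if k ^ 2 < s' ∧ s' ≤ K ^ 2 then s' - k ^ 2 else 0) := by
  refine Measurable.ite ?_ (measurable_id.sub measurable_const) measurable_const
  exact (measurableSet_lt measurable_const measurable_id).inter (measurableSet_le measurable_id measurable_const)

/-- The witness weight vanishes below `k²`. [folklore] -/
theorem Rrad_eq_zero_of_le {k K s' : ℝ} (h : s' ≤ k ^ 2) :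
    (if k ^ 2 < s' ∧ s' ≤ K ^ 2 then s' - k ^ 2 else 0) = 0 := by
  rw [if_neg]
  exact fun h' => (not_lt.2 h) h'.1

/-- The witness weight is nonnegative. [folklore] -/
theorem Rrad_nonneg (k K s' : ℝ) : 0 ≤ (if k ^ 2 < s' ∧ s' ≤ K ^ 2 then s' - k ^ 2 else 0) := by
  split_ifs with h
  · linarith [h.1]
  · exact le_rfl

/-- The witness weight is admissible: `|R(s′)| ≤ |s′|`. [folklore] -/
theorem abs_Rrad_le (k K s' : ℝ) : |(if k ^ 2 < s' ∧ s' ≤ K ^ 2 then s' - k ^ 2 else 0)| ≤ |s'| := by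
  rw [abs_of_nonneg (Rrad_nonneg k K s')]
  split_ifs with h
  · have : 0 ≤ s' := by nlinarith [h.1, sq_nonneg k]
    rw [abs_of_nonneg this]
    nlinarith [sq_nonneg k]
  · exact abs_nonneg _

/-- The band cube `1{k < ‖v‖ ≤ K} ‖v‖³` is nonnegative. [folklore] -/
theorem bandCube_nonneg (k K : ℝ) (v : V3) : 0 ≤ (if k < ‖v‖ ∧ ‖v‖ ≤ K then ‖v‖ ^ 3 else 0) := by
  split_ifs <;> positivity

/-- Band membership in terms of the squared speed. [folklore] -/
theorem band_iff {k K : ℝ} (hk : 0 ≤ k) (hK : 0 ≤ K) (v : V3) :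
    (k ^ 2 < ‖v‖ ^ 2 ∧ ‖v‖ ^ 2 ≤ K ^ 2) ↔ (k < ‖v‖ ∧ ‖v‖ ≤ K) := by
  rw [sq_lt_sq, sq_le_sq, abs_of_nonneg hk, abs_of_nonneg hK, abs_of_nonneg (norm_nonneg v)]

/-- `‖R(‖v‖²) • v‖ ≤ 1{k < ‖v‖ ≤ K} ‖v‖³`: the witness weight is supported in the band. [folklore] -/
theorem norm_Rrad_smul_le {k K : ℝ} (hk : 0 ≤ k) (hK : 0 ≤ K) (v : V3) :
    ‖(if k ^ 2 < ‖v‖ ^ 2 ∧ ‖v‖ ^ 2 ≤ K ^ 2 then ‖v‖ ^ 2 - k ^ 2 else 0) • v‖ ≤ (if k < ‖v‖ ∧ ‖v‖ ≤ K then ‖v‖ ^ 3 else 0) := by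
  rw [norm_smul, Real.norm_eq_abs, abs_of_nonneg (Rrad_nonneg _ _ _)]
  by_cases h : k ^ 2 < ‖v‖ ^ 2 ∧ ‖v‖ ^ 2 ≤ K ^ 2
  · rw [if_pos h, if_pos ((band_iff hk hK v).1 h)]
    have : 0 ≤ ‖v‖ := norm_nonneg v
    nlinarith [sq_nonneg k]
  · rw [if_neg h, zero_mul]
    split_ifs <;> positivity

/-- `|R(‖v‖²) v₀| ≤ K³` (bounded one-body observable). [folklore] -/
theorem abs_Rrad_mul_coord_le {k K : ℝ} (hk : 0 ≤ k) (hK : 0 ≤ K) (v : V3) :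
    |(if k ^ 2 < ‖v‖ ^ 2 ∧ ‖v‖ ^ 2 ≤ K ^ 2 then ‖v‖ ^ 2 - k ^ 2 else 0) * v 0| ≤ K ^ 3 := by
  have h1 : |(if k ^ 2 < ‖v‖ ^ 2 ∧ ‖v‖ ^ 2 ≤ K ^ 2 then ‖v‖ ^ 2 - k ^ 2 else 0) * v 0| ≤ ‖(if k ^ 2 < ‖v‖ ^ 2 ∧ ‖v‖ ^ 2 ≤ K ^ 2 then ‖v‖ ^ 2 - k ^ 2 else 0) • v‖ := by
    rw [abs_mul, norm_smul, Real.norm_eq_abs]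
    exact mul_le_mul_of_nonneg_left (by simpa using PiLp.norm_apply_le v 0) (abs_nonneg _)
  refine h1.trans ((norm_Rrad_smul_le hk hK v).trans ?_)
  split_ifs with h
  · exact pow_le_pow_left₀ (norm_nonneg _) h.2 3
  · positivity


/-! ## §2 Pathwise window facts for a measurable signal `W : ℝ → ℝ³` on `[0, w]` -/

section Window

variable {k K w : ℝ} {W : ℝ → V3}

/-- The band cube along a measurable signal is integrable on every bounded interval (bounded by `K³`). [folklore] -/
theorem intervalIntegrable_bandCube (hK : 0 ≤ K) (hWm : Measurable W) (a b : ℝ) :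
    IntervalIntegrable (fun r => (if k < ‖W r‖ ∧ ‖W r‖ ≤ K then ‖W r‖ ^ 3 else 0)) volume a b := by
  have hm : Measurable fun r => (if k < ‖W r‖ ∧ ‖W r‖ ≤ K then ‖W r‖ ^ 3 else 0) := by
    refine Measurable.ite ?_ (hWm.norm.pow_const 3) measurable_const
    exact (measurableSet_lt measurable_const hWm.norm).inter (measurableSet_le hWm.norm measurable_const)
  refine (intervalIntegrable_const (c := K ^ 3)).mono_fun' hm.aestronglyMeasurable (ae_of_all _ fun r => ?_)
  show ‖(if k < ‖W r‖ ∧ ‖W r‖ ≤ K then ‖W r‖ ^ 3 else 0)‖ ≤ K ^ 3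
  rw [Real.norm_eq_abs, abs_of_nonneg (bandCube_nonneg _ _ _)]
  split_ifs with h
  · exact pow_le_pow_left₀ (norm_nonneg _) h.2 3
  · positivity

/-- The weighted signal `R(‖W‖²) • W` is integrable on every bounded interval (dominated by the band cube). [folklore] -/
theorem intervalIntegrable_Rrad_smul (hk : 0 ≤ k) (hK : 0 ≤ K) (hWm : Measurable W) (a b : ℝ) :
    IntervalIntegrable (fun r => (if k ^ 2 < ‖W r‖ ^ 2 ∧ ‖W r‖ ^ 2 ≤ K ^ 2 then ‖W r‖ ^ 2 - k ^ 2 else 0) • W r) volume a b := by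
  refine (intervalIntegrable_bandCube (k := k) hK hWm a b).mono_fun
    (((measurable_Rrad k K).comp (hWm.norm.pow_const 2)).smul hWm).aestronglyMeasurable (ae_of_all _ fun r => ?_)
  show ‖(if k ^ 2 < ‖W r‖ ^ 2 ∧ ‖W r‖ ^ 2 ≤ K ^ 2 then ‖W r‖ ^ 2 - k ^ 2 else 0) • W r‖ ≤ ‖(if k < ‖W r‖ ∧ ‖W r‖ ≤ K then ‖W r‖ ^ 3 else 0)‖
  rw [Real.norm_eq_abs ((if k < ‖W r‖ ∧ ‖W r‖ ≤ K then ‖W r‖ ^ 3 else 0)), abs_of_nonneg (bandCube_nonneg _ _ _)]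
  exact norm_Rrad_smul_le hk hK (W r)

/-- **`‖q̄‖ ≤ cubBand`** for the witness weight: `‖w⁻¹ • ∫₀ʷ R(‖W‖²) • W‖ ≤ w⁻¹ ∫₀ʷ 1{k<‖W‖≤K}‖W‖³`. [folklore] -/
theorem norm_qbar_le_cubBand (hw : 0 < w) (hk : 0 ≤ k) (hK : 0 ≤ K) (hWm : Measurable W) :
    ‖w⁻¹ • ∫ r in (0 : ℝ)..w, (if k ^ 2 < ‖W r‖ ^ 2 ∧ ‖W r‖ ^ 2 ≤ K ^ 2 then ‖W r‖ ^ 2 - k ^ 2 else 0) • W r‖ ≤ w⁻¹ * ∫ r in (0 : ℝ)..w, (if k < ‖W r‖ ∧ ‖W r‖ ≤ K then ‖W r‖ ^ 3 else 0) := by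
  rw [norm_smul, Real.norm_eq_abs, abs_of_pos (inv_pos.2 hw)]
  refine mul_le_mul_of_nonneg_left ?_ (inv_pos.2 hw).le
  rw [intervalIntegral.integral_of_le hw.le, intervalIntegral.integral_of_le hw.le]
  exact norm_integral_le_of_norm_le (intervalIntegrable_bandCube (k := k) hK hWm 0 w).1
    (ae_of_all _ fun r => norm_Rrad_smul_le hk hK (W r))

/-- The `0`-coordinate of `q̄` is the window average of the scalar `R(‖W‖²) W₀`. [folklore] -/
theorem qbar_apply_zero (hk : 0 ≤ k) (hK : 0 ≤ K) (hWm : Measurable W) :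
    (w⁻¹ • ∫ r in (0 : ℝ)..w, (if k ^ 2 < ‖W r‖ ^ 2 ∧ ‖W r‖ ^ 2 ≤ K ^ 2 then ‖W r‖ ^ 2 - k ^ 2 else 0) • W r) 0 =
      w⁻¹ * ∫ r in (0 : ℝ)..w, (if k ^ 2 < ‖W r‖ ^ 2 ∧ ‖W r‖ ^ 2 ≤ K ^ 2 then ‖W r‖ ^ 2 - k ^ 2 else 0) * (W r) 0 := by
  have h := (EuclideanSpace.proj (𝕜 := ℝ) (0 : Fin 3)).intervalIntegral_comp_comm
    (intervalIntegrable_Rrad_smul hk hK hWm 0 w)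
  have h' : (∫ r in (0 : ℝ)..w, (if k ^ 2 < ‖W r‖ ^ 2 ∧ ‖W r‖ ^ 2 ≤ K ^ 2 then ‖W r‖ ^ 2 - k ^ 2 else 0) • W r) 0 =
      ∫ r in (0 : ℝ)..w, (if k ^ 2 < ‖W r‖ ^ 2 ∧ ‖W r‖ ^ 2 ≤ K ^ 2 then ‖W r‖ ^ 2 - k ^ 2 else 0) * (W r) 0 := by
    have h2 : (EuclideanSpace.proj (𝕜 := ℝ) (0 : Fin 3)) (∫ r in (0 : ℝ)..w, (if k ^ 2 < ‖W r‖ ^ 2 ∧ ‖W r‖ ^ 2 ≤ K ^ 2 then ‖W r‖ ^ 2 - k ^ 2 else 0) • W r) =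
        (∫ r in (0 : ℝ)..w, (if k ^ 2 < ‖W r‖ ^ 2 ∧ ‖W r‖ ^ 2 ≤ K ^ 2 then ‖W r‖ ^ 2 - k ^ 2 else 0) • W r) 0 := rfl
    rw [← h2, ← h]
    refine intervalIntegral.integral_congr fun r _ => ?_
    show ((if k ^ 2 < ‖W r‖ ^ 2 ∧ ‖W r‖ ^ 2 ≤ K ^ 2 then ‖W r‖ ^ 2 - k ^ 2 else 0) • W r) 0 = _
    rw [PiLp.smul_apply, smul_eq_mul]
  rw [PiLp.smul_apply, smul_eq_mul, h']

/-- The window cube is nonnegative (no integrability needed). [folklore] -/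
theorem cub_nonneg (hw : 0 ≤ w) (W : ℝ → V3) : 0 ≤ w⁻¹ * ∫ r in (0 : ℝ)..w, ‖W r‖ ^ 3 :=
  mul_nonneg (inv_nonneg.2 hw) (intervalIntegral.integral_nonneg hw fun r _ => by positivity)

/-- **The coherence summand dominates the linear functional `q̄₀ − η·cub`** (pathwise, for a measurable signal):
`1{η cub < ‖q̄‖} cubBand ≥ q̄₀ − η cub`. [folklore] -/
theorem linear_le_summand (hw : 0 < w) (hk : 0 ≤ k) (hK : 0 ≤ K) {η : ℝ} (hη : 0 ≤ η) (hWm : Measurable W) :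
    w⁻¹ * (∫ r in (0 : ℝ)..w, (if k ^ 2 < ‖W r‖ ^ 2 ∧ ‖W r‖ ^ 2 ≤ K ^ 2 then ‖W r‖ ^ 2 - k ^ 2 else 0) * (W r) 0) - η * (w⁻¹ * ∫ r in (0 : ℝ)..w, ‖W r‖ ^ 3) ≤
      (if η * (w⁻¹ * ∫ r in (0 : ℝ)..w, ‖W r‖ ^ 3) < ‖w⁻¹ • ∫ r in (0 : ℝ)..w, (if k ^ 2 < ‖W r‖ ^ 2 ∧ ‖W r‖ ^ 2 ≤ K ^ 2 then ‖W r‖ ^ 2 - k ^ 2 else 0) • W r‖ then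
        w⁻¹ * ∫ r in (0 : ℝ)..w, (if k < ‖W r‖ ∧ ‖W r‖ ≤ K then ‖W r‖ ^ 3 else 0) else 0) := by
  have hq := norm_qbar_le_cubBand hw hk hK hWm
  have h0 : w⁻¹ * (∫ r in (0 : ℝ)..w, (if k ^ 2 < ‖W r‖ ^ 2 ∧ ‖W r‖ ^ 2 ≤ K ^ 2 then ‖W r‖ ^ 2 - k ^ 2 else 0) * (W r) 0) ≤
      ‖w⁻¹ • ∫ r in (0 : ℝ)..w, (if k ^ 2 < ‖W r‖ ^ 2 ∧ ‖W r‖ ^ 2 ≤ K ^ 2 then ‖W r‖ ^ 2 - k ^ 2 else 0) • W r‖ := by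
    rw [← qbar_apply_zero hk hK hWm]
    exact (le_abs_self _).trans (by simpa using PiLp.norm_apply_le (w⁻¹ • ∫ r in (0 : ℝ)..w, (if k ^ 2 < ‖W r‖ ^ 2 ∧ ‖W r‖ ^ 2 ≤ K ^ 2 then ‖W r‖ ^ 2 - k ^ 2 else 0) • W r) 0)
  have hc := cub_nonneg hw.le W
  split_ifs with h
  · linarith [mul_nonneg hη hc]
  · linarith [not_lt.1 h]

end Window


end BandCoherenceLDNegative

end Summit.AtomisticToContinuum.HydrodynamicLimit.Theorems

end
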